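import Literature.NumberTheory.GaloisCohomology.Howard2004.InertEigenlinesProofs
import Literature.Algebra.Module.EigenLengthCount
import HarnessLib

/-!
# Howard 2004, Lemma 1.5.3: the (GD-line) count `length_R loc_q(H¹_{F^q(n)}(K, T̄) ∩ H¹(K, T̄)^ε) = 1` at an inert
# prime (the `hGD` letter of `EigenSelmerParityProofs`), from `#A·#A = #H¹(K_q, T̄)` and the eigenLINES (theorems only)

Topic `NumberTheory/GaloisCohomology/Howard2004`. THEOREMS ONLY: no definition, no named fact, no instance, no notation,
no `sorry`. Cell `pub/bsd-print-x9`, print leaf G87 `Literature.NumberTheory.GaloisCohomology.Howard2004.thm161_dvrKolyvaginBound`;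
seat `bsd-line-x10b-p1-w5` g8, (GD-COUNT) — the LAST Galois letter of Lemma 1.5.3 after (DICH) `EigenSelmerDichotomyProofs`
and (EIG-LINES) `InertEigenlinesProofs`; module-theoretic core `Algebra/Module/EigenLengthCount`.

SOURCE. B. Howard, *The Heegner point Kolyvagin system*, Compositio Math. **140** (2004) = arXiv:1202.6340, Lemma 1.5.3,
proof (p. 10 L10–19): «By global duality the images of the rightmost arrows are exact orthogonal complements under the
`G_ℚ`-invariant local Tate pairing. Furthermore the action of complex conjugation splits `H¹_f(K_ℓ, T̄)` and `H¹_s(K_ℓ, T̄)`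
each into one-dimensional eigenspaces … It follows that `H¹_{F(n)}(K, T̄)^± = H¹_{F^ℓ(n)}(K, T̄)^±`»; Lemma 1.5.6
(p. 10 L84–97: `A = A^⟂`, `len(A) = 2k·ν`). READ AT THE RESIDUAL LEVEL: `A := loc_q H¹_{F^q(n)}(K, T̄)` is `τ_q`-stable,
isotropic, with `#A·#A = #H¹(K_q, T̄)` (`RelaxedSelmerLagrangianCountProofs.natCard_map_localization_selmerGroup_mul_self`);
`H¹(K_q, T̄) = H⁺ ⊕ H⁻` with `H^± = H¹_f^± ⊕ H¹_tr^±` of length `2` and non-degenerate (`InertLocalPairingInvarianceProofs`);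
hence `A^± = A ∩ H^±` have length `1`, and `A ∩ H^ε = loc_q(S ∩ E^ε)` by the projector `½(1 + ε τ)`.

WHAT IS PROVED.
* §1 `ResidualTau.thetaH1_scalarMapH1`, `thetaH1_transportH1_cast_scalarMapH1` — `θ_*` and `τ_q` commute with the
  functorial scalars (the eigenparts are `R`-submodules).
* §2 **`DualityDatum.length_map_inf_eigen_eq_one`**: for `ε = ±1`, `S ≤ H¹(K, T̄)` `τ_*`-stable, `E = {τ_* c = ε c}`,
  `loc_q S` isotropic with `#loc_q S · #loc_q S = #H¹(K_q, T̄)`, and the letters of (DICH)/(EIG-LINES) (`hdis`, `hsplit`,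
  `hstabf/t`, `hdec`, `hline`, `hwit`, `horth`, `hnd`, odd exponent `hodd`, `𝔪 H¹ = 0`):
  `length_R (submoduleOfStable _ ((S ⊓ E).map loc_q) _) = 1` — VERBATIM the hypothesis `hGD` of
  `EigenSelmerParityProofs.length_inf_comap_add_one_eq_of_exists` / `…_eq_add_one_of_forall` at `Sum.inr q` (the
  `submoduleOfStable` proof argument is irrelevant).

LETTERS and their suppliers: `hcard` ← A-PERP-COUNT p698314 (with the residual datum and (READ-H2)); `hdec`/`hline`/`hwit` ←
`InertEigenlinesProofs` (p704642 + §4); `horth` ← `EigenSelmerDichotomyProofs.localCup_transportH1_cast_eq_zero_of_eq_of_eq_neg_of_readings`;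
`hnd` ← `RelaxedSelmerLagrangianCountProofs.eq_zero_of_forall_localCup_transportH1_cast_eq_zero`; `hsplit`/`hdis` ← Prop. 1.1.9
(x9-p1-w3); `hiso` ← `RelaxedSelmerIsotropyProofs` + (READ-H2); `hS` ← `ResidualTau.semilinearH_mem_selmerGroup`.
NOT HERE: those letters; `thm161_dvrKolyvaginBound` is NOT proved; no summit statement is proved; the Birch–Swinnerton-Dyer
conjecture is not proved by any of this.
References: [Howard2004HeegnerKolyvagin] Lemma 1.5.3, Lemma 1.5.6, Prop. 1.1.7/1.1.9, H.5.
-/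

set_option autoImplicit false

noncomputable section

open Function NumberField IsDedekindDomain Field CategoryTheory
open scoped NumberField

namespace Literature.NumberTheory.GaloisCohomology.Howard2004

open Literature.NumberTheory.GaloisRepresentations
open Literature.NumberTheory.GaloisRepresentations.DiscreteGaloisModule
open Literature.NumberTheory.EllipticCurves
open Literature.Algebra.Module

variable {K : Type} [Field K] [NumberField K] {Nbar : Type} [AddCommGroup Nbar]
  [TopologicalSpace Nbar] [DiscreteTopology Nbar] {R : Type} [CommRing R] [TopologicalSpace R] [DiscreteTopology R]
  [Module R Nbar] {p : ℕ} [Fact p.Prime] [Algebra ℤ_[p] R]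
  {cd : ConjugationDatum K} {ρbar : DiscreteGaloisModule K Nbar}

namespace ResidualTau

/-! ## §1 `τ_q` commutes with the scalars -/

omit [TopologicalSpace R] [DiscreteTopology R] [Fact p.Prime] [Algebra ℤ_[p] R] in
/-- **`θ_*` commutes with the functorial scalars**: `θ_* (r • z) = r • θ_* z` on `H¹(K_v, ·)` (`θ` is `R`-linear).
[cite: Howard2004HeegnerKolyvagin, §1.3 H.5(a) (arXiv p. 7 L93–95) and Def. 1.1.1 (R-linearity)] -/
theorem thetaH1_scalarMapH1 (A : ResidualTau (R := R) cd ρbar) (hρ : ρbar.IsScalarLinear R) (v : Place K) (r : R)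
    (z : galoisCohomology ((cd.twist ρbar).toLocal v) 1) :
    A.thetaH1 v (galoisCohomology.scalarMapH1 ((cd.twist ρbar).toLocal v)
        (DualityDatum.isScalarLinear_twist_toLocal cd hρ v) r z) =
      galoisCohomology.scalarMapH1 (ρbar.toLocal v) (DualityDatum.isScalarLinear_toLocal hρ v) r (A.thetaH1 v z) := by
  obtain ⟨g, rfl⟩ := oneCocycleClass_surjective _ z
  have hθ : ∀ χ : contOneCocycles ((cd.twist ρbar).toLocal v).toTopRep,
      A.thetaH1 v (oneCocycleClass _ χ) = oneCocycleClass _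
        (contOneCocycles.pullback (ContinuousMonoidHom.id _)
          (X := ((cd.twist ρbar).toLocal v).toTopRep) (Y := (ρbar.toLocal v).toTopRep)
          (TopRep.ofHom ⟨⟨A.θ.toAddMonoidHom.toIntLinearMap, continuous_of_discreteTopology⟩,
            fun g => ContinuousLinearMap.ext fun x =>
              A.compat (absGaloisRestrict K (Place.Completion v) g) x⟩) χ) :=
    fun χ => map_oneCocycleClass _ _ _ χ
  rw [galoisCohomology.scalarMapH1_oneCocycleClass, hθ, hθ, galoisCohomology.scalarMapH1_oneCocycleClass]
  congr 1
  refine Subtype.ext (ContinuousMap.ext fun σ => ?_)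
  change A.θ (r • g.1 σ) = r • A.θ (g.1 σ)
  rw [map_smul]

omit [TopologicalSpace R] [DiscreteTopology R] [Fact p.Prime] [Algebra ℤ_[p] R] in
/-- **`τ_q` commutes with the scalars** at an inert prime: `τ_q (r • x) = r • τ_q x`.
[cite: Howard2004HeegnerKolyvagin, §1.3 (arXiv p. 7 L44–48) and Def. 1.1.1] -/
theorem thetaH1_transportH1_cast_scalarMapH1 (A : ResidualTau (R := R) cd ρbar) (hρ : ρbar.IsScalarLinear R)
    {q : HeightOneSpectrum (𝓞 K)} (h : cd.σ • q = q) (r : R) (x : galoisCohomology (ρbar.toLocal (Sum.inr q)) 1) :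
    A.thetaH1 (Sum.inr q) (cd.transportH1 ρbar q
        (h.symm ▸ galoisCohomology.scalarMapH1 (ρbar.toLocal (Sum.inr q))
          (DualityDatum.isScalarLinear_toLocal hρ (Sum.inr q)) r x :
          galoisCohomology (ρbar.toLocal (Sum.inr (cd.σ • q))) 1)) =
      galoisCohomology.scalarMapH1 (ρbar.toLocal (Sum.inr q)) (DualityDatum.isScalarLinear_toLocal hρ (Sum.inr q)) r
        (A.thetaH1 (Sum.inr q) (cd.transportH1 ρbar q
          (h.symm ▸ x : galoisCohomology (ρbar.toLocal (Sum.inr (cd.σ • q))) 1))) := by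
  rw [cd.transportH1_cast_scalarMapH1 ρbar hρ h r x, A.thetaH1_scalarMapH1 hρ (Sum.inr q) r]

end ResidualTau

namespace DualityDatum

/-! ## §2 The (GD-line) count at an inert prime -/

variable (Dbar : DualityDatum p cd ρbar R) (A : ResidualTau (R := R) cd ρbar) (hρ : ρbar.IsScalarLinear R)
  {q : HeightOneSpectrum (𝓞 K)} (h : cd.σ • q = q)

/-- **Howard's Lemma 1.5.3, the (GD-line) count, as a kernel theorem modulo named letters**: at an inert prime `q`
(`h : σ q = q`), with `V = H¹(K_q, T̄) = H¹_f ⊕ H¹_tr`, each summand the sum of its two `τ_q`-eigenLINES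
(`InertEigenlinesProofs`), `S = H¹_{F^q(n)}(K, T̄)` `τ_*`-stable with `A = loc_q S` isotropic of cardinality
`#A·#A = #V` (Lemma 1.5.6, `RelaxedSelmerLagrangianCountProofs.natCard_map_localization_selmerGroup_mul_self`), opposite
eigenparts orthogonal and `⟨ , ⟩_q` left non-degenerate: **`length_R loc_q(S ⊓ E^ε) = 1`** for the `ε`-eigen subgroup
`E^ε = {c | τ_* c = ε c}` — VERBATIM the hypothesis `hGD` of `EigenSelmerParityProofs.length_inf_comap_add_one_eq_of_exists` /
`…_eq_add_one_of_forall` at `Sum.inr q`. [cite: Howard2004HeegnerKolyvagin, Lemma 1.5.3 proof (arXiv p. 10 L10–19) with Lemma 1.5.6 (p. 10 L84–97)] -/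
theorem length_map_inf_eigen_eq_one [IsLocalRing R] [Finite (R ⧸ IsLocalRing.maximalIdeal R)]
    [Finite (galoisCohomology (ρbar.toLocal (Sum.inr q)) 1)]
    {ε : ℤ} (hε : ε = 1 ∨ ε = -1) (S E : AddSubgroup (galoisCohomology ρbar 1))
    (hE : ∀ c, c ∈ E ↔ semilinearH cd.isLift A.θ.toAddMonoidHom A.isSemilinear 1 c = ε • c)
    (hS : ∀ c ∈ S, semilinearH cd.isLift A.θ.toAddMonoidHom A.isSemilinear 1 c ∈ S)
    (hAS : ∀ (r : R) {x}, x ∈ S.map (galoisCohomology.localization ρbar (Sum.inr q) 1) →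
      galoisCohomology.scalarMapH1 (ρbar.toLocal (Sum.inr q)) (hρ.restrictField (Place.Completion (Sum.inr q))) r x ∈
        S.map (galoisCohomology.localization ρbar (Sum.inr q) 1))
    (hAE : ∀ (r : R) {x}, x ∈ (S ⊓ E).map (galoisCohomology.localization ρbar (Sum.inr q) 1) →
      galoisCohomology.scalarMapH1 (ρbar.toLocal (Sum.inr q)) (hρ.restrictField (Place.Completion (Sum.inr q))) r x ∈
        (S ⊓ E).map (galoisCohomology.localization ρbar (Sum.inr q) 1))
    (hiso : ∀ c ∈ S, ∀ d ∈ S, Dbar.localCup (Sum.inr q) (galoisCohomology.localization ρbar (Sum.inr q) 1 c)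
      (cd.transportH1 ρbar q (h.symm ▸ galoisCohomology.localization ρbar (Sum.inr q) 1 d :
        galoisCohomology (ρbar.toLocal (Sum.inr (cd.σ • q))) 1)) = 0)
    (hcard : Nat.card ↥(S.map (galoisCohomology.localization ρbar (Sum.inr q) 1)) *
        Nat.card ↥(S.map (galoisCohomology.localization ρbar (Sum.inr q) 1)) =
      Nat.card (galoisCohomology (ρbar.toLocal (Sum.inr q)) 1))
    (Lf Lt : AddSubgroup (galoisCohomology (ρbar.toLocal (Sum.inr q)) 1)) (hdis : Disjoint Lf Lt)
    (hsplit : ∀ y, ∃ a ∈ Lf, ∃ b ∈ Lt, y = a + b)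
    (hLf : ∀ (r : R) {x}, x ∈ Lf →
      galoisCohomology.scalarMapH1 (ρbar.toLocal (Sum.inr q)) (hρ.restrictField (Place.Completion (Sum.inr q))) r x ∈ Lf)
    (hLt : ∀ (r : R) {x}, x ∈ Lt →
      galoisCohomology.scalarMapH1 (ρbar.toLocal (Sum.inr q)) (hρ.restrictField (Place.Completion (Sum.inr q))) r x ∈ Lt)
    (hstabf : ∀ u ∈ Lf, A.thetaH1 (Sum.inr q) (cd.transportH1 ρbar q
        (h.symm ▸ u : galoisCohomology (ρbar.toLocal (Sum.inr (cd.σ • q))) 1)) ∈ Lf)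
    (hstabt : ∀ v ∈ Lt, A.thetaH1 (Sum.inr q) (cd.transportH1 ρbar q
        (h.symm ▸ v : galoisCohomology (ρbar.toLocal (Sum.inr (cd.σ • q))) 1)) ∈ Lt)
    (hdec : ∀ L : AddSubgroup (galoisCohomology (ρbar.toLocal (Sum.inr q)) 1), (L = Lf ∨ L = Lt) →
      ∀ b ∈ L, ∃ b₁ ∈ L, ∃ b₂ ∈ L,
        A.thetaH1 (Sum.inr q) (cd.transportH1 ρbar q
            (h.symm ▸ b₁ : galoisCohomology (ρbar.toLocal (Sum.inr (cd.σ • q))) 1)) = b₁ ∧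
          A.thetaH1 (Sum.inr q) (cd.transportH1 ρbar q
            (h.symm ▸ b₂ : galoisCohomology (ρbar.toLocal (Sum.inr (cd.σ • q))) 1)) = -b₂ ∧ b = b₁ + b₂)
    (hline : ∀ L : AddSubgroup (galoisCohomology (ρbar.toLocal (Sum.inr q)) 1), (L = Lf ∨ L = Lt) →
      ∀ ε' : ℤ, ε' = 1 ∨ ε' = -1 → ∀ v ∈ L,
        A.thetaH1 (Sum.inr q) (cd.transportH1 ρbar q
            (h.symm ▸ v : galoisCohomology (ρbar.toLocal (Sum.inr (cd.σ • q))) 1)) = ε' • v → v ≠ 0 →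
          ∀ b ∈ L, A.thetaH1 (Sum.inr q) (cd.transportH1 ρbar q
              (h.symm ▸ b : galoisCohomology (ρbar.toLocal (Sum.inr (cd.σ • q))) 1)) = ε' • b →
            ∃ r : R, b = galoisCohomology.scalarMapH1 (ρbar.toLocal (Sum.inr q))
              (DualityDatum.isScalarLinear_toLocal hρ (Sum.inr q)) r v)
    (hwit : ∀ L : AddSubgroup (galoisCohomology (ρbar.toLocal (Sum.inr q)) 1), (L = Lf ∨ L = Lt) →
      ∀ ε' : ℤ, ε' = 1 ∨ ε' = -1 → ∃ v ∈ L, v ≠ 0 ∧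
        A.thetaH1 (Sum.inr q) (cd.transportH1 ρbar q
          (h.symm ▸ v : galoisCohomology (ρbar.toLocal (Sum.inr (cd.σ • q))) 1)) = ε' • v)
    (horth : ∀ x y : galoisCohomology (ρbar.toLocal (Sum.inr q)) 1,
      A.thetaH1 (Sum.inr q) (cd.transportH1 ρbar q
          (h.symm ▸ x : galoisCohomology (ρbar.toLocal (Sum.inr (cd.σ • q))) 1)) = x →
        A.thetaH1 (Sum.inr q) (cd.transportH1 ρbar q
          (h.symm ▸ y : galoisCohomology (ρbar.toLocal (Sum.inr (cd.σ • q))) 1)) = -y →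
        Dbar.localCup (Sum.inr q) x (cd.transportH1 ρbar q
            (h.symm ▸ y : galoisCohomology (ρbar.toLocal (Sum.inr (cd.σ • q))) 1)) = 0 ∧
          Dbar.localCup (Sum.inr q) y (cd.transportH1 ρbar q
            (h.symm ▸ x : galoisCohomology (ρbar.toLocal (Sum.inr (cd.σ • q))) 1)) = 0)
    (hnd : ∀ u : galoisCohomology (ρbar.toLocal (Sum.inr q)) 1,
      (∀ y, Dbar.localCup (Sum.inr q) u (cd.transportH1 ρbar q
        (h.symm ▸ y : galoisCohomology (ρbar.toLocal (Sum.inr (cd.σ • q))) 1)) = 0) → u = 0)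
    (hodd : ∃ N : ℕ, Odd N ∧ ∀ x : galoisCohomology (ρbar.toLocal (Sum.inr q)) 1, N • x = 0)
    (hm : ∀ a ∈ IsLocalRing.maximalIdeal R, ∀ x : galoisCohomology (ρbar.toLocal (Sum.inr q)) 1,
      galoisCohomology.scalarMapH1 (ρbar.toLocal (Sum.inr q)) (hρ.restrictField (Place.Completion (Sum.inr q))) a x = 0) :
    (letI := galoisCohomology.moduleH1 (ρbar.toLocal (Sum.inr q)) (hρ.restrictField (Place.Completion (Sum.inr q)));
      Module.length R ↥(galoisCohomology.submoduleOfStable (hρ.restrictField (Place.Completion (Sum.inr q)))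
        ((S ⊓ E).map (galoisCohomology.localization ρbar (Sum.inr q) 1)) hAE)) = 1 := by
  classical
  letI inst := galoisCohomology.moduleH1 (ρbar.toLocal (Sum.inr q)) (hρ.restrictField (Place.Completion (Sum.inr q)))
  -- notation: `τ`, `B`, `loc`
  let τ : galoisCohomology (ρbar.toLocal (Sum.inr q)) 1 →+ galoisCohomology (ρbar.toLocal (Sum.inr q)) 1 :=
    AddMonoidHom.mk' (fun y => A.thetaH1 (Sum.inr q) (cd.transportH1 ρbar q
        (h.symm ▸ y : galoisCohomology (ρbar.toLocal (Sum.inr (cd.σ • q))) 1)))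
      (A.thetaH1_transportH1_cast_add h)
  have hτ : ∀ y, τ y = A.thetaH1 (Sum.inr q) (cd.transportH1 ρbar q
      (h.symm ▸ y : galoisCohomology (ρbar.toLocal (Sum.inr (cd.σ • q))) 1)) := fun _ => rfl
  let B : galoisCohomology (ρbar.toLocal (Sum.inr q)) 1 → galoisCohomology (ρbar.toLocal (Sum.inr q)) 1 →
      galoisCohomology (Dbar.twistOne.toLocal (Sum.inr q)) 2 := fun x y =>
    Dbar.localCup (Sum.inr q) x (cd.transportH1 ρbar q
      (h.symm ▸ y : galoisCohomology (ρbar.toLocal (Sum.inr (cd.σ • q))) 1))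
  have hBadd : ∀ x y y', B x (y + y') = B x y + B x y' := fun x y y' => by
    change Dbar.localCup (Sum.inr q) x _ = _
    rw [cd.transportH1_cast_add ρbar h y y', map_add]
  let loc := galoisCohomology.localization ρbar (Sum.inr q) 1
  let τg := semilinearH cd.isLift A.θ.toAddMonoidHom A.isSemilinear 1
  have hτloc : ∀ c, τ (loc c) = loc (τg c) := fun c => A.thetaH1_transportH1_cast_localization h c
  have hτsmul : ∀ (r : R) x, τ (r • x) = r • τ x := fun r x => A.thetaH1_transportH1_cast_scalarMapH1 hρ h r x
  have hε2 : ε * ε = 1 := by rcases hε with rfl | rfl <;> norm_num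
  -- `2` is invertible on `V`: `(2 (m+1)) • x = x`
  obtain ⟨N, ⟨m, rfl⟩, hN⟩ := hodd
  have htwo : ∀ x : galoisCohomology (ρbar.toLocal (Sum.inr q)) 1, (m + 1) • (x + x) = x := by
    intro x
    have h1 : (m + 1) • (x + x) = (2 * m + 1) • x + x := by rw [← two_nsmul, ← mul_nsmul', show (m+1)*2 = (2*m+1)+1 by ring, add_nsmul, one_nsmul]
    rw [h1, hN x, zero_add]
  -- `τ² = id` on `V` (from the eigen-decompositions of `Lf` and `Lt`)
  have hdecV : ∀ x, ∃ x₁ x₂, τ x₁ = x₁ ∧ τ x₂ = -x₂ ∧ x = x₁ + x₂ := by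
    intro x
    obtain ⟨a, ha, b, hb, rfl⟩ := hsplit x
    obtain ⟨a₁, -, a₂, -, ha₁, ha₂, rfl⟩ := hdec Lf (Or.inl rfl) a ha
    obtain ⟨b₁, -, b₂, -, hb₁, hb₂, rfl⟩ := hdec Lt (Or.inr rfl) b hb
    refine ⟨a₁ + b₁, a₂ + b₂, ?_, ?_, by abel⟩
    · rw [map_add, hτ, hτ, ha₁, hb₁]
    · rw [map_add, hτ, hτ, ha₂, hb₂, neg_add]
  have hττ : ∀ x, τ (τ x) = x := by
    intro x
    obtain ⟨x₁, x₂, h₁, h₂, rfl⟩ := hdecV x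
    rw [map_add, h₁, h₂, map_add, map_neg, h₁, h₂, neg_neg]
  -- the two projectors
  have hproj : ∀ x, τ ((m + 1) • (x + τ x)) = (m + 1) • (x + τ x) ∧
      τ ((m + 1) • (x - τ x)) = -((m + 1) • (x - τ x)) ∧ x = (m + 1) • (x + τ x) + (m + 1) • (x - τ x) := by
    intro x
    refine ⟨?_, ?_, ?_⟩
    · rw [map_nsmul, map_add, hττ, add_comm (τ x) x]
    · rw [map_nsmul, map_sub, hττ, ← neg_sub x (τ x), smul_neg]
    · rw [← nsmul_add, add_add_sub_cancel, htwo]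
  -- the eigen submodules `Hp`, `Hm`
  let Hp : Submodule R (galoisCohomology (ρbar.toLocal (Sum.inr q)) 1) :=
    { carrier := {x | τ x = x}
      add_mem' := fun {x y} hx hy => by change τ (x + y) = x + y; rw [map_add, hx, hy]
      zero_mem' := by change τ 0 = 0; exact map_zero τ
      smul_mem' := fun r x hx => by change τ (r • x) = r • x; rw [hτsmul, hx] }
  let Hm : Submodule R (galoisCohomology (ρbar.toLocal (Sum.inr q)) 1) :=
    { carrier := {x | τ x = -x}
      add_mem' := fun {x y} hx hy => by change τ (x + y) = -(x + y); rw [map_add, hx, hy, neg_add]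
      zero_mem' := by change τ 0 = -0; rw [map_zero, neg_zero]
      smul_mem' := fun r x hx => by change τ (r • x) = -(r • x); rw [hτsmul, hx, smul_neg] }
  have hHp : ∀ x, x ∈ Hp ↔ τ x = x := fun _ => Iff.rfl
  have hHm : ∀ x, x ∈ Hm ↔ τ x = -x := fun _ => Iff.rfl
  -- `𝔪` kills `V`
  have hmV : ∀ a ∈ IsLocalRing.maximalIdeal R, ∀ x : galoisCohomology (ρbar.toLocal (Sum.inr q)) 1, a • x = 0 := hm
  -- eigenvectors in `Lf` / `Lt` are multiples of the witnesses: `Hp = R uf ⊔ R ut`, `Hm = R uf' ⊔ R ut'`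
  have hcomp : ∀ (s : ℤ), s = 1 ∨ s = -1 → ∀ a ∈ Lf, ∀ b ∈ Lt, τ (a + b) = s • (a + b) →
      τ a = s • a ∧ τ b = s • b := by
    intro s hs a ha b hb hab
    have h1 : τ a - s • a ∈ Lf := Lf.sub_mem (hstabf a ha) (Lf.zsmul_mem ha s)
    have h2 : τ b - s • b ∈ Lt := Lt.sub_mem (hstabt b hb) (Lt.zsmul_mem hb s)
    have hsum : (τ a - s • a) + (τ b - s • b) = 0 := by
      rw [map_add, smul_add] at hab; rw [sub_add_sub_comm, hab, sub_self]
    have h0 : τ a - s • a = 0 := by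
      refine (AddSubgroup.disjoint_def.mp hdis) h1 ?_
      rw [eq_neg_of_add_eq_zero_left hsum]; exact Lt.neg_mem h2
    refine ⟨sub_eq_zero.mp h0, ?_⟩
    rw [h0, zero_add] at hsum
    exact sub_eq_zero.mp hsum
  have heigen_eq : ∀ (s : ℤ) (hs : s = 1 ∨ s = -1) (uf ut : galoisCohomology (ρbar.toLocal (Sum.inr q)) 1),
      uf ∈ Lf → uf ≠ 0 → τ uf = s • uf → ut ∈ Lt → ut ≠ 0 → τ ut = s • ut →
      (∀ x, τ x = s • x ↔ x ∈ (R ∙ uf) ⊔ (R ∙ ut)) := by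
    intro s hs uf ut huf huf0 hτuf hut hut0 hτut x
    constructor
    · intro hx
      obtain ⟨a, ha, b, hb, rfl⟩ := hsplit x
      obtain ⟨hτa, hτb⟩ := hcomp s hs a ha b hb hx
      obtain ⟨r, hr⟩ := hline Lf (Or.inl rfl) s hs uf huf hτuf huf0 a ha hτa
      obtain ⟨r', hr'⟩ := hline Lt (Or.inr rfl) s hs ut hut hτut hut0 b hb hτb
      refine Submodule.mem_sup.mpr ⟨a, ?_, b, ?_, rfl⟩
      · rw [hr]; exact Submodule.smul_mem _ r (Submodule.mem_span_singleton_self uf)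
      · rw [hr']; exact Submodule.smul_mem _ r' (Submodule.mem_span_singleton_self ut)
    · intro hx
      obtain ⟨a, ha, b, hb, rfl⟩ := Submodule.mem_sup.mp hx
      obtain ⟨r, rfl⟩ := Submodule.mem_span_singleton.mp ha
      obtain ⟨r', rfl⟩ := Submodule.mem_span_singleton.mp hb
      rw [map_add, hτsmul, hτsmul, hτuf, hτut, smul_add, smul_comm r s uf, smul_comm r' s ut]
  -- lengths of the eigen submodules
  have hlen2 : ∀ (s : ℤ) (hs : s = 1 ∨ s = -1) (H : Submodule R (galoisCohomology (ρbar.toLocal (Sum.inr q)) 1)),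
      (∀ x, x ∈ H ↔ τ x = s • x) → Module.length R H = 2 ∧ ∃ u ∈ Lf, u ≠ 0 ∧ u ∈ H := by
    intro s hs H hH
    obtain ⟨uf, huf, huf0, hτuf⟩ := hwit Lf (Or.inl rfl) s hs
    obtain ⟨ut, hut, hut0, hτut⟩ := hwit Lt (Or.inr rfl) s hs
    rw [← hτ] at hτuf hτut
    have hHeq : H = (R ∙ uf) ⊔ (R ∙ ut) := by
      ext x; rw [hH]; exact heigen_eq s hs uf ut huf huf0 hτuf hut hut0 hτut x
    have hdis' : Disjoint (R ∙ uf) (R ∙ ut) := by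
      rw [Submodule.disjoint_def]
      intro x hx hx'
      obtain ⟨r, rfl⟩ := Submodule.mem_span_singleton.mp hx
      have h1 : r • uf ∈ Lf := hLf r huf
      have h2 : r • uf ∈ Lt := by
        obtain ⟨r', hr'⟩ := Submodule.mem_span_singleton.mp hx'
        rw [← hr']; exact hLt r' hut
      exact (AddSubgroup.disjoint_def.mp hdis) h1 h2
    refine ⟨?_, uf, huf, huf0, (hH uf).mpr hτuf⟩
    rw [hHeq, length_sup_eq_add_of_disjoint _ _ hdis',
      length_span_singleton_eq_one huf0 (fun a ha => hmV a ha uf),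
      length_span_singleton_eq_one hut0 (fun a ha => hmV a ha ut)]
    rfl
  have hHp1 : ∀ x, x ∈ Hp ↔ τ x = (1 : ℤ) • x := fun x => by rw [one_zsmul]; exact hHp x
  have hHm1 : ∀ x, x ∈ Hm ↔ τ x = (-1 : ℤ) • x := fun x => by rw [neg_one_zsmul]; exact hHm x
  obtain ⟨hlenHp, uf, hufL, huf0, hufH⟩ := hlen2 1 (Or.inl rfl) Hp hHp1
  obtain ⟨hlenHm, uf', huf'L, huf'0, huf'H⟩ := hlen2 (-1) (Or.inr rfl) Hm hHm1
  -- the local image `A' = loc_q S` as a submodule; it is `τ`-stable and splits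
  let A' : Submodule R (galoisCohomology (ρbar.toLocal (Sum.inr q)) 1) :=
    galoisCohomology.submoduleOfStable (hρ.restrictField (Place.Completion (Sum.inr q))) (S.map loc) hAS
  have hA'mem : ∀ x, x ∈ A' ↔ x ∈ S.map loc := fun x => galoisCohomology.mem_submoduleOfStable_iff _ _ _ x
  have hA'τ : ∀ x ∈ A', τ x ∈ A' := by
    intro x hx
    obtain ⟨c, hc, rfl⟩ := (hA'mem x).mp hx
    rw [hA'mem]
    exact ⟨τg c, hS c hc, (hτloc c).symm⟩
  have hsplitA : ∀ a ∈ A', ∃ ap ∈ A' ⊓ Hp, ∃ am ∈ A' ⊓ Hm, a = ap + am := by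
    intro a ha
    obtain ⟨h1, h2, h3⟩ := hproj a
    refine ⟨(m + 1) • (a + τ a), ⟨A'.nsmul_mem (A'.add_mem ha (hA'τ a ha)) _, h1⟩,
      (m + 1) • (a - τ a), ⟨A'.nsmul_mem (A'.sub_mem ha (hA'τ a ha)) _, h2⟩, h3⟩
  -- `A'` is isotropic
  have hisoA : ∀ x ∈ A', ∀ y ∈ A', B x y = 0 := by
    intro x hx y hy
    obtain ⟨c, hc, rfl⟩ := (hA'mem x).mp hx
    obtain ⟨d, hd, rfl⟩ := (hA'mem y).mp hy
    exact hiso c hc d hd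
  -- `A'` contains neither eigen submodule (non-degeneracy)
  have hnotp : ¬ Hp ≤ A' := by
    intro hle
    apply huf0
    refine hnd uf fun y => ?_
    obtain ⟨h1, h2, h3⟩ := hproj y
    have e : B uf y = B uf ((m + 1) • (y + τ y)) + B uf ((m + 1) • (y - τ y)) := by
      conv_lhs => rw [h3]
      exact hBadd uf _ _
    have h0 : B uf ((m + 1) • (y - τ y)) = 0 := (horth uf _ hufH h2).1
    change B uf y = 0
    rw [e, hisoA uf (hle hufH) _ (hle h1), h0, add_zero]
  have hnotm : ¬ Hm ≤ A' := by
    intro hle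
    apply huf'0
    refine hnd uf' fun y => ?_
    obtain ⟨h1, h2, h3⟩ := hproj y
    have e : B uf' y = B uf' ((m + 1) • (y + τ y)) + B uf' ((m + 1) • (y - τ y)) := by
      conv_lhs => rw [h3]
      exact hBadd uf' _ _
    have h0 : B uf' ((m + 1) • (y + τ y)) = 0 := (horth _ uf' h1 huf'H).2
    change B uf' y = 0
    rw [e, h0, hisoA uf' (hle huf'H) _ (hle h2), zero_add]
  -- `length A' = 2` from the count `#A·#A = #V`
  have hk : 2 ≤ Nat.card (R ⧸ IsLocalRing.maximalIdeal R) := by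
    haveI : Nontrivial (R ⧸ IsLocalRing.maximalIdeal R) := Ideal.Quotient.nontrivial_iff.mpr
      (IsLocalRing.maximalIdeal.isMaximal R).ne_top
    have := Finite.one_lt_card (α := R ⧸ IsLocalRing.maximalIdeal R)
    omega
  have hlenV : Module.length R (galoisCohomology (ρbar.toLocal (Sum.inr q)) 1) = 4 := by
    have htop : (⊤ : Submodule R (galoisCohomology (ρbar.toLocal (Sum.inr q)) 1)) = Hp ⊔ Hm := by
      refine le_antisymm (fun x _ => ?_) le_top
      obtain ⟨h1, h2, h3⟩ := hproj x
      exact Submodule.mem_sup.mpr ⟨_, h1, _, h2, h3.symm⟩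
    have hdisH : Disjoint Hp Hm := by
      rw [Submodule.disjoint_def]
      intro x hx hx'
      have hx1 : τ x = x := hx
      have hx2 : τ x = -x := hx'
      have h2x : (m + 1) • (x + x) = x := htwo x
      have : x + x = 0 := by
        nth_rewrite 2 [← hx1]; rw [hx2, add_neg_cancel]
      rw [this, smul_zero] at h2x
      exact h2x.symm
    rw [← Submodule.topEquiv.length_eq, htop, length_sup_eq_add_of_disjoint _ _ hdisH, hlenHp, hlenHm]
    rfl
  have hlenA : Module.length R A' = 2 := by
    obtain ⟨hAfin, hAcard⟩ := natCard_eq_pow_length (IsLocalRing.maximalIdeal R) (M := A')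
      (fun a ha x => Subtype.ext (hmV a ha x.1))
    obtain ⟨-, hVcard⟩ := natCard_eq_pow_length (IsLocalRing.maximalIdeal R)
      (M := galoisCohomology (ρbar.toLocal (Sum.inr q)) 1) hmV
    rw [hlenV] at hVcard
    have hV4 : Nat.card (galoisCohomology (ρbar.toLocal (Sum.inr q)) 1) =
        Nat.card (R ⧸ IsLocalRing.maximalIdeal R) ^ 4 := by simpa using hVcard
    have hcardA' : Nat.card A' = Nat.card ↥(S.map loc) :=
      Nat.card_congr (Equiv.subtypeEquivRight fun x => hA'mem x)
    rw [hcardA'] at hAcard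
    have hexp : Nat.card (R ⧸ IsLocalRing.maximalIdeal R) ^ ((Module.length R A').toNat + (Module.length R A').toNat) =
        Nat.card (R ⧸ IsLocalRing.maximalIdeal R) ^ 4 := by
      rw [pow_add, ← hAcard, ← hV4]; exact hcard
    have h4 : (Module.length R A').toNat + (Module.length R A').toNat = 4 := Nat.pow_right_injective hk hexp
    have h2' : (Module.length R A').toNat = 2 := by omega
    rw [← ENat.coe_toNat hAfin, h2']
    rfl
  -- the module-theoretic count
  obtain ⟨hp1, hm1⟩ := length_inf_eq_one_of_split Hp Hm A' hlenHp hlenHm hlenA hsplitA hnotp hnotm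
  -- `loc_q (S ⊓ E) = A' ⊓ H^ε`
  have hAEmem : ∀ x, x ∈ (S ⊓ E).map loc ↔ x ∈ A' ∧ τ x = ε • x := by
    intro x
    constructor
    · rintro ⟨c, hc, rfl⟩
      refine ⟨(hA'mem _).mpr ⟨c, hc.1, rfl⟩, ?_⟩
      rw [hτloc, (hE c).mp hc.2, map_zsmul]
    · rintro ⟨hx, hτx⟩
      obtain ⟨c, hc, rfl⟩ := (hA'mem _).mp hx
      -- the projected preimage `c' = (m+1) • (c + ε τ_* c)`
      refine ⟨(m + 1) • (c + ε • τg c), ⟨S.nsmul_mem (S.add_mem hc (S.zsmul_mem (hS c hc) ε)) _, ?_⟩, ?_⟩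
      · refine (hE _).mpr ?_
        rw [map_nsmul, map_add, map_zsmul]
        change (m + 1) • (τg c + ε • τg (τg c)) = ε • (m + 1) • (c + ε • τg c)
        rw [A.semilinearH_semilinearH c, smul_comm ε (m + 1)]
        congr 1
        rw [smul_add, smul_smul, hε2, one_smul, add_comm]
      · rw [map_nsmul, map_add, map_zsmul, ← hτloc, hτx, smul_smul, hε2, one_smul, htwo]
  rcases hε with rfl | rfl
  · have heq : galoisCohomology.submoduleOfStable (hρ.restrictField (Place.Completion (Sum.inr q)))
        ((S ⊓ E).map loc) hAE = A' ⊓ Hp := by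
      refine le_antisymm (fun x hx => ?_) (fun x hx => ?_)
      · have hx' := ((hAEmem x).mp ((galoisCohomology.mem_submoduleOfStable_iff _ _ _ x).mp hx))
        rw [one_zsmul] at hx'
        exact ⟨hx'.1, hx'.2⟩
      · refine (galoisCohomology.mem_submoduleOfStable_iff _ _ _ x).mpr ((hAEmem x).mpr ⟨hx.1, ?_⟩)
        rw [one_zsmul]; exact hx.2
    rw [heq]; exact hp1
  · have heq : galoisCohomology.submoduleOfStable (hρ.restrictField (Place.Completion (Sum.inr q)))
        ((S ⊓ E).map loc) hAE = A' ⊓ Hm := by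
      refine le_antisymm (fun x hx => ?_) (fun x hx => ?_)
      · have hx' := ((hAEmem x).mp ((galoisCohomology.mem_submoduleOfStable_iff _ _ _ x).mp hx))
        rw [neg_one_zsmul] at hx'
        exact ⟨hx'.1, hx'.2⟩
      · refine (galoisCohomology.mem_submoduleOfStable_iff _ _ _ x).mpr ((hAEmem x).mpr ⟨hx.1, ?_⟩)
        rw [neg_one_zsmul]; exact hx.2
    rw [heq]; exact hm1

end DualityDatum

end Literature.NumberTheory.GaloisCohomology.Howard2004
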